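import Mathlib
import Summits.AnomalousDissipation.AnomalousDissipation.Theses.DyadicWallCascade

/-!
# Strategy census — typed signatures for crux `HalfSpaceHierarchy` (stmt-AnomalousDissipation-18627)

Crux-strategist seat `planner-cstrat-stmt-AnomalousDissipation-18627-s1-0`, 2026-08-17.
Companion of `Cruxes/HalfSpaceHierarchy/STRATEGY-CENSUS.md`; nothing here is a registered stub or a
route item.  Contents:

* `Body extra` — the crux clause block with one extra clause on `(V, Q)`; `Body.toCrux` (proved):
  every strengthening implies the crux.
* Strengthenings recorded in the census with their fate:
  `IrrotationalHierarchy` (S⁺₁, provably FALSE: harmonic ⇒ analytic ⇒ all dyadic periods ⇒ V = V(z)),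
  `AnalyticHierarchy` (S⁺₂, provably FALSE, same identity-theorem argument),
  `HalfTurnReversibleHierarchy` (S⁺₃, FALSE in one line: F is odd under a reversing isometry),
  `MirrorSymmetricHierarchy` (S⁺₄, the design symmetry the route needs anyway; buys nothing).
* Decomposition D1 (slab reformulation): `SlabHierarchy` (the crux localised to the open slab
  `1/2 < z < 4`), `halfSpace_to_slab` (proved, restriction) and the genuine support lemma
  `SlabExtension : SlabHierarchy → HalfSpaceHierarchy` (stated; equivariant extension, M/L-sized).
-/

namespace Summit.AnomalousDissipation.AnomalousDissipation.Cruxes.HalfSpaceHierarchy.StrategyCensus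

open MeasureTheory
open Summit.AnomalousDissipation.AnomalousDissipation.Theses.DyadicWallCascade

/-- The crux clause block (verbatim the route decl `HalfSpaceHierarchy`) with one extra clause. -/
def Body (extra : (EuclideanSpace ℝ (Fin 3) → EuclideanSpace ℝ (Fin 3)) → (EuclideanSpace ℝ (Fin 3) → ℝ) → Prop) : Prop :=
  ∃ (V : EuclideanSpace ℝ (Fin 3) → EuclideanSpace ℝ (Fin 3)) (Q : EuclideanSpace ℝ (Fin 3) → ℝ) (C F : ℝ), let H : Set (EuclideanSpace ℝ (Fin 3)) := {X | 0 < X 2}; let e : Fin 3 → EuclideanSpace ℝ (Fin 3) := fun i => EuclideanSpace.single i (1 : ℝ); let pt : ℝ × ℝ → EuclideanSpace ℝ (Fin 3) := fun q => !₂[q.1, q.2, (1 : ℝ)]; (ContDiffOn ℝ ((⊤ : ℕ∞) : WithTop ℕ∞) V H ∧ ContDiffOn ℝ ((⊤ : ℕ∞) : WithTop ℕ∞) Q H ∧ (∀ X ∈ H, ‖V X‖ ≤ C ∧ |Q X| ≤ C) ∧ (∀ X ∈ H, ∑ i : Fin 3, (fderiv ℝ V X (e i)) i = 0) ∧ (∀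 X ∈ H, (fderiv ℝ V X) (V X) + gradient Q X = 0) ∧ (∀ X ∈ H, V ((2 : ℝ) • X) = V X ∧ Q ((2 : ℝ) • X) = Q X) ∧ (∀ X : EuclideanSpace ℝ (Fin 3), 1 ≤ X 2 → X 2 ≤ 2 → V (X + e 0) = V X ∧ V (X + e 1) = V X ∧ Q (X + e 0) = Q X ∧ Q (X + e 1) = Q X) ∧ (∫ q in Set.Icc (0 : ℝ) 1 ×ˢ Set.Icc (0 : ℝ) 1, (V (pt q)) 2 = 0) ∧ F ≠ 0 ∧ (∫ q in Set.Icc (0 : ℝ) 1 ×ˢ Set.Icc (0 : ℝ) 1, (V (pt q)) 2 * (‖V (pt q)‖ ^ 2 / 2 + Q (pt q)) = F)) ∧ extra V Q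

/-- Every strengthening `Body extra` implies the crux (drop the extra clause). -/
theorem Body.toCrux {extra : (EuclideanSpace ℝ (Fin 3) → EuclideanSpace ℝ (Fin 3)) → (EuclideanSpace ℝ (Fin 3) → ℝ) → Prop}
    (h : Body extra) : HalfSpaceHierarchy := by
  obtain ⟨V, Q, C, F, hbody, _hextra⟩ := h
  exact ⟨V, Q, C, F, hbody⟩

/-- The crux is `Body` with the trivial extra clause. -/
theorem crux_iff_body_true : HalfSpaceHierarchy ↔ Body (fun _ _ => True) := by
  constructor
  · rintro ⟨V, Q, C, F, hbody⟩
    exact ⟨V, Q, C, F, hbody, trivial⟩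
  · exact Body.toCrux

/-! ## Strengthenings (census §Strengthen) -/

/-- S⁺₁ — IRROTATIONAL witness (`curl V = 0` on the half-space, written as symmetry of the Jacobian).
Census: provably FALSE (each component of `V` is then harmonic on `H`, hence real-analytic; the band
periodicity propagates to all of `H`, the dilation then gives every period `2^{-k} e_i`, so `V = V(z)`,
`div V = 0` forces `V₃` constant, the zero-mass-flux clause forces `V₃ = 0`, hence `F = 0`).  Hence also:
no witness is a perturbation of a potential through-flow — there is no potential base flow at all. -/
def IrrotationalHierarchy : Prop :=
  Body fun V _ => ∀ X : EuclideanSpace ℝ (Fin 3), 0 < X 2 → ∀ i j : Fin 3,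
    (fderiv ℝ V X (EuclideanSpace.single i (1 : ℝ))) j = (fderiv ℝ V X (EuclideanSpace.single j (1 : ℝ))) i

/-- S⁺₂ — REAL-ANALYTIC witness.  Census: provably FALSE by the same identity-theorem argument (the
refuter's "trace tower": any witness is `C^∞` and nowhere analytic across the dyadic planes). -/
def AnalyticHierarchy : Prop :=
  Body fun V Q => AnalyticOnNhd ℝ V {X | 0 < X 2} ∧ AnalyticOnNhd ℝ Q {X | 0 < X 2}

/-- S⁺₃ — witness REVERSIBLE under the half-turn `R(x, y, z) = (-x, -y, z)`: `V (R X) = -R (V X)`,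
`Q (R X) = Q X` (the shape of hypothesis under which Lortz-type closed-streamline iterations work).
Census: FALSE in one line — `R` preserves the plane `z = 1` and the unit cell up to translation by a
period, and `V₃ ∘ R = -V₃`, `B ∘ R = B`, so `F = -F`.  Every reversing lattice isometry is excluded the
same way: `F ≠ 0` forbids reversibility, so Lortz 1970 / Bineau-type closed-line schemes cannot apply. -/
def HalfTurnReversibleHierarchy : Prop :=
  Body fun V Q => ∀ X : EuclideanSpace ℝ (Fin 3),
    V (!₂[-(X 0), -(X 1), X 2]) = !₂[(V X) 0, (V X) 1, -((V X) 2)] ∧ Q (!₂[-(X 0), -(X 1), X 2]) = Q X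

/-- S⁺₄ — witness with the two vertical mirror symmetries `x ↦ -x`, `y ↦ -y` (NOT reversing: `V` is
pushed forward, not negated).  This is the design symmetry the route needs anyway (it gives the refuter's
constraints `⟨ω₃ g(B)⟩ = 0`, zero helicity flux and `⟨V₃ V_h⟩ = 0` for free).  Census: consistent, adds
rigidity, but buys nothing for the existence step (the obstruction is 3-D smooth steady Euler with
non-constant Bernoulli function, untouched by discrete symmetries). -/
def MirrorSymmetricHierarchy : Prop :=
  Body fun V Q => ∀ X : EuclideanSpace ℝ (Fin 3),
    (V (!₂[-(X 0), X 1, X 2]) = !₂[-((V X) 0), (V X) 1, (V X) 2] ∧ Q (!₂[-(X 0), X 1, X 2]) = Q X) ∧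
    (V (!₂[X 0, -(X 1), X 2]) = !₂[(V X) 0, -((V X) 1), (V X) 2] ∧ Q (!₂[X 0, -(X 1), X 2]) = Q X)

theorem IrrotationalHierarchy.toCrux (h : IrrotationalHierarchy) : HalfSpaceHierarchy := Body.toCrux h
theorem AnalyticHierarchy.toCrux (h : AnalyticHierarchy) : HalfSpaceHierarchy := Body.toCrux h
theorem HalfTurnReversibleHierarchy.toCrux (h : HalfTurnReversibleHierarchy) : HalfSpaceHierarchy := Body.toCrux h
theorem MirrorSymmetricHierarchy.toCrux (h : MirrorSymmetricHierarchy) : HalfSpaceHierarchy := Body.toCrux h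

/-! ## Decomposition D1 — slab reformulation (census §Decomposition)

`SlabHierarchy`: the same clauses on the OPEN slab `S = {1/2 < z < 4}` only, with the dilation relation
asked where both `X` and `2X` lie in `S`.  `HalfSpaceHierarchy → SlabHierarchy` is restriction (proved
below); `SlabExtension : SlabHierarchy → HalfSpaceHierarchy` is the genuine (support-grade) lemma:
extend by `V(X) := V(2^{-k} X)` for `2^k ≤ z < 2^{k+1}`; smoothness across every dyadic plane is
inherited from smoothness INSIDE the slab near `z = 1` and `z = 2`, boundedness from the closed band.
The analytic content of the crux is untouched: `SlabHierarchy` is the crux on a compact-modulo-periods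
domain — it remains the whole crux. -/
def SlabHierarchy : Prop :=
  ∃ (V : EuclideanSpace ℝ (Fin 3) → EuclideanSpace ℝ (Fin 3)) (Q : EuclideanSpace ℝ (Fin 3) → ℝ) (C F : ℝ), let S : Set (EuclideanSpace ℝ (Fin 3)) := {X | 1 / 2 < X 2 ∧ X 2 < 4}; let e : Fin 3 → EuclideanSpace ℝ (Fin 3) := fun i => EuclideanSpace.single i (1 : ℝ); let pt : ℝ × ℝ → EuclideanSpace ℝ (Fin 3) := fun q => !₂[q.1, q.2, (1 : ℝ)]; ContDiffOn ℝ ((⊤ : ℕ∞) : WithTop ℕ∞) V S ∧ ContDiffOn ℝ ((⊤ : ℕ∞) : WithTop ℕ∞) Q S ∧ (∀ X ∈ S, ‖V X‖ ≤ C ∧ |Q X| ≤ C) ∧ (∀ X ∈ S, ∑ i : Fin 3, (fderiv ℝ V X (e i)) i = 0) ∧ (∀ X ∈ S, (fderiv ℝ V X) (V X) + gradient Q X = 0) ∧ (∀ X : EuclideanSpace ℝ (Fin 3), 1 / 2 < X 2 → X 2 < 2 → V ((2 : ℝ) • X) = V X ∧ Q ((2 : ℝ) • X) = Q X) ∧ (∀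 X : EuclideanSpace ℝ (Fin 3), 1 ≤ X 2 → X 2 ≤ 2 → V (X + e 0) = V X ∧ V (X + e 1) = V X ∧ Q (X + e 0) = Q X ∧ Q (X + e 1) = Q X) ∧ (∫ q in Set.Icc (0 : ℝ) 1 ×ˢ Set.Icc (0 : ℝ) 1, (V (pt q)) 2 = 0) ∧ F ≠ 0 ∧ (∫ q in Set.Icc (0 : ℝ) 1 ×ˢ Set.Icc (0 : ℝ) 1, (V (pt q)) 2 * (‖V (pt q)‖ ^ 2 / 2 + Q (pt q)) = F)

/-- The support lemma of D1 (STATED, not proved here): equivariant extension from the slab. -/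
def SlabExtension : Prop := SlabHierarchy → HalfSpaceHierarchy

/-- Restriction direction of D1 (proved): a half-space hierarchy restricts to a slab hierarchy. -/
theorem halfSpace_to_slab (h : HalfSpaceHierarchy) : SlabHierarchy := by
  obtain ⟨V, Q, C, F, hbody⟩ := h
  dsimp only at hbody
  obtain ⟨h1, h2, h3, h4, h5, h6, h7, h8, h9, h10⟩ := hbody
  have hsub : ({X | 1 / 2 < X 2 ∧ X 2 < 4} : Set (EuclideanSpace ℝ (Fin 3))) ⊆ {X | 0 < X 2} := by
    intro X hX
    simp only [Set.mem_setOf_eq] at hX ⊢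
    linarith [hX.1]
  refine ⟨V, Q, C, F, ?_⟩
  dsimp only
  refine ⟨h1.mono hsub, h2.mono hsub, fun X hX => h3 X (hsub hX), fun X hX => h4 X (hsub hX),
    fun X hX => h5 X (hsub hX), fun X hX1 _hX2 => h6 X ?_, h7, h8, h9, h10⟩
  simp only [Set.mem_setOf_eq]
  linarith

/-- D1 assembled: the crux from the two pieces (modus ponens; the seam is trivial by design — the
content is in `SlabExtension` (bookkeeping, provable) and in `SlabHierarchy` (the whole crux)). -/
theorem HalfSpaceHierarchy_of_slab (h₁ : SlabHierarchy) (h₂ : SlabExtension) : HalfSpaceHierarchy := h₂ h₁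

end Summit.AnomalousDissipation.AnomalousDissipation.Cruxes.HalfSpaceHierarchy.StrategyCensus
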